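import Mathlib
import Summits.NavierStokesRegularity.NavierStokesRegularity.Theorems.EulerZoomLiouvillePowerGaugeEulerLiouvilleBootstrapEnergy
import HarnessLib

/-!
# The flux strata of the open core, THRESHOLD-FREE: every `ρ > 0`
# (crux `EulerZoomLiouville.PowerGaugeEulerLiouville` = stmt-NavierStokesRegularity-19832, lead's line `birth`)

Route `EulerZoomLiouville` (NavierStokesRegularity).  With the threshold-free global energy inequality of the class
(`lintegral_enorm_sq_antitone_ae_of_gauge`, `…BootstrapEnergy.lean`: bootstrap in scale + pressure splitting + the tree's
proved Calderón–Zygmund bound) the three energy strata of the open core `stub_noCollapseFromZero` hold for EVERY exponent,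
the crux's hypotheses VERBATIM plus one hypothesis each (previous files: `ρ > 2/5`, then `ρ > 2/9`, then finite energy):

* `ae_eq_zero_of_gauge_of_energyVanishing_allRho` / `powerGaugeEulerLiouville_of_energyVanishing_allRho` —
  «NO EULER COLLAPSE FROM AN ENERGY-QUIESCENT PAST»: `ess liminf_{s→−∞} ∫|u(s)|² = 0 ⇒ u ≡ 0` (`ρ ≥ 0` / `ρ > 0`);
* `powerGaugeEulerLiouville_fromRest_allRho` — «NO EULER COLLAPSE FROM REST» (`ρ > 0`; was `ρ > 2/5` in `…WindowFlux`);
* `powerGaugeEulerLiouville_of_tightPast_allRho` — «NO BACKWARD-TIGHT NONTRIVIAL MEMBER» (`ρ > 0`): a nontrivial member sends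
  its energy to spatial infinity backward in time (composes STUB 2 `Backward.stub_backwardVanishing`).

So, for every `ρ ∈ (0, 1/2]`, the open core is EXACTLY the class of members whose energy is present at `t = −∞`: never
quiescent, never at rest, not backward-tight, never increasing once finite — the portrait of the in-window self-similar / DSS
Euler collapse candidates (Chae–Shvydkoy window).  WHAT THIS IS NOT: not NS regularity, not the open core itself;
kernel-checked strata `--supports` stmt-19832. [folklore]
-/

noncomputable section

set_option linter.dupNamespace false

open MeasureTheory Set Filter Topology Metric Function TopologicalSpace
open scoped ENNReal NNReal

namespace Summit.NavierStokesRegularity.NavierStokesRegularity.Theorems.PowerGaugeEulerLiouville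

open Literature.Analysis Literature.Analysis.FunctionSpaces Literature.Analysis.FluidPDE

/-- **Energy-quiescent past ⇒ trivial, every `ρ ≥ 0`.**  A member of the power-gauged class for which, for every `ε > 0`
and `N`, the times `s < −N` with `∫_{ℝ³}|u(s)|² ≤ ε` have positive measure, vanishes a.e.: pick such times in the full-measure
set of good starts of `lintegral_enorm_sq_antitone_ae_of_gauge`; after them the energy is `≤ ε`. [folklore] -/
theorem ae_eq_zero_of_gauge_of_energyVanishing_allRho {ρ : ℝ} (hρ : 0 ≤ ρ)
    {u : ℝ → EuclideanSpace ℝ (Fin 3) → EuclideanSpace ℝ (Fin 3)} {p : ℝ → EuclideanSpace ℝ (Fin 3) → ℝ}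
    {H : ℝ → EuclideanSpace ℝ (Fin 3) → EuclideanSpace ℝ (Fin 3) →L[ℝ] EuclideanSpace ℝ (Fin 3)} {c : ℝ≥0}
    (hsw : IsSuitableWeakSolutionOn (slab (EuclideanSpace ℝ (Fin 3)) (Iio 0) isOpen_Iio) 0 0 u p)
    (hH : HasWeakSpatialGradientOn (slab (EuclideanSpace ℝ (Fin 3)) (Iio 0) isOpen_Iio) u H)
    (hc : ∀ a : ℝ, 0 < a → ENNReal.ofReal (a ^ (2 * ρ)) * cknA a (0 : ℝ × EuclideanSpace ℝ (Fin 3)) u +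
        ENNReal.ofReal (a ^ ρ) * cknE a (0 : ℝ × EuclideanSpace ℝ (Fin 3)) H +
        ENNReal.ofReal (a ^ (2 * ρ)) * cknD a (0 : ℝ × EuclideanSpace ℝ (Fin 3)) p ≤ (c : ℝ≥0∞))
    (hvan : ∀ ε : ℝ, 0 < ε → ∀ N : ℝ,
      volume {s : ℝ | s < -N ∧ ∫⁻ x, ‖u s x‖ₑ ^ 2 ≤ ENNReal.ofReal ε} ≠ 0) :
    uncurry u =ᵐ[volume.restrict (Iio (0 : ℝ) ×ˢ (univ : Set (EuclideanSpace ℝ (Fin 3))))] 0 := by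
  have hanti := lintegral_enorm_sq_antitone_ae_of_gauge hρ hsw hH hc
  have hmeasU : AEStronglyMeasurable (uncurry u)
      (volume.restrict (Iio (0 : ℝ) ×ˢ (univ : Set (EuclideanSpace ℝ (Fin 3))))) := by
    have := hH.locallyIntegrableOn.aestronglyMeasurable
    simpa [slab] using this
  -- quiescent good start times, arbitrarily far back
  have hGc : volume {s : ℝ | ¬ (s < 0 → ∀ᵐ t ∂(volume : Measure ℝ), t ∈ Ioo s 0 →
      ∫⁻ x, ‖u t x‖ₑ ^ 2 ≤ ∫⁻ x, ‖u s x‖ₑ ^ 2)} = 0 := ae_iff.1 hanti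
  have hpick : ∀ m N : ℕ, ∃ s₀ : ℝ, s₀ < -(N : ℝ) ∧
      (∀ᵐ t ∂(volume : Measure ℝ), t ∈ Ioo s₀ 0 → ∫⁻ x, ‖u t x‖ₑ ^ 2 ≤ ∫⁻ x, ‖u s₀ x‖ₑ ^ 2) ∧
      ∫⁻ y, ‖u s₀ y‖ₑ ^ 2 ≤ ENNReal.ofReal (1 / ((m : ℝ) + 1)) := by
    intro m N
    set A : Set ℝ := {s : ℝ | s < -(N : ℝ) ∧ ∫⁻ y, ‖u s y‖ₑ ^ 2 ≤ ENNReal.ofReal (1 / ((m : ℝ) + 1))} with hAdef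
    have hApos : volume A ≠ 0 := hvan _ (by positivity) N
    obtain ⟨s₀, hs₀A, hs₀G⟩ : ∃ s₀, s₀ ∈ A ∧ (s₀ < 0 → ∀ᵐ t ∂(volume : Measure ℝ), t ∈ Ioo s₀ 0 →
        ∫⁻ x, ‖u t x‖ₑ ^ 2 ≤ ∫⁻ x, ‖u s₀ x‖ₑ ^ 2) := by
      by_contra hne
      apply hApos
      refine measure_mono_null (fun s hs => ?_) hGc
      intro hgoods
      exact hne ⟨s, hs, hgoods⟩
    have hs₀neg : s₀ < 0 := lt_of_lt_of_le hs₀A.1 (by simp)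
    exact ⟨s₀, hs₀A.1, hs₀G hs₀neg, hs₀A.2⟩
  choose S hSN hSgood hSsmall using hpick
  have hall : ∀ᵐ t ∂(volume : Measure ℝ), ∀ m N : ℕ, t ∈ Ioo (S m N) 0 →
      ∫⁻ x, ‖u t x‖ₑ ^ 2 ≤ ENNReal.ofReal (1 / ((m : ℝ) + 1)) :=
    ae_all_iff.2 fun m => ae_all_iff.2 fun N => by
      filter_upwards [hSgood m N] with t ht htm
      exact (ht htm).trans (hSsmall m N)
  -- a.e. slice vanishes
  have hslice0 : ∀ᵐ t ∂(volume.restrict (Iio (0 : ℝ))), u t =ᵐ[volume] 0 := by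
    rw [ae_restrict_iff' measurableSet_Iio]
    have hm := hmeasU
    rw [Measure.volume_eq_prod, ← Measure.restrict_prod_eq_prod_univ] at hm
    have hmslice : ∀ᵐ t ∂(volume.restrict (Iio (0 : ℝ))), AEStronglyMeasurable (fun y => uncurry u (t, y)) volume :=
      hm.prodMk_left
    rw [ae_restrict_iff' measurableSet_Iio] at hmslice
    filter_upwards [hall, hmslice] with t ht hmt htneg
    have hmt' : AEStronglyMeasurable (u t) volume := hmt htneg
    have hzero : ∫⁻ x, ‖u t x‖ₑ ^ 2 = 0 := by
      refine le_antisymm ?_ zero_le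
      have hbound : ∀ m : ℕ, ∫⁻ x, ‖u t x‖ₑ ^ 2 ≤ ENNReal.ofReal (1 / ((m : ℝ) + 1)) := by
        intro m
        set N : ℕ := ⌈-t⌉₊ with hN
        have hSt : S m N < t := by
          have h1 : -t ≤ (N : ℝ) := Nat.le_ceil _
          have h2 := hSN m N
          linarith
        exact ht m N ⟨hSt, htneg⟩
      have hlim : Tendsto (fun m : ℕ => ENNReal.ofReal (1 / ((m : ℝ) + 1))) atTop (𝓝 (ENNReal.ofReal 0)) :=
        ENNReal.tendsto_ofReal tendsto_one_div_add_atTop_nhds_zero_nat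
      rw [ENNReal.ofReal_zero] at hlim
      exact ge_of_tendsto' hlim hbound
    have hae := (lintegral_eq_zero_iff' (hmt'.aemeasurable.enorm.pow_const 2)).1 hzero
    filter_upwards [hae] with x hx
    have hx' : ‖u t x‖ₑ ^ 2 = 0 := hx
    rwa [pow_eq_zero_iff two_ne_zero, enorm_eq_zero] at hx'
  have hint : ∫⁻ z in Iio (0 : ℝ) ×ˢ (univ : Set (EuclideanSpace ℝ (Fin 3))), ‖uncurry u z‖ₑ = 0 := by
    have hm := hmeasU.aemeasurable.enorm
    rw [Measure.volume_eq_prod, ← Measure.restrict_prod_eq_prod_univ] at hm ⊢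
    rw [lintegral_prod _ hm]
    have hz : (fun t : ℝ => ∫⁻ y, ‖uncurry u (t, y)‖ₑ) =ᵐ[volume.restrict (Iio 0)] 0 := by
      filter_upwards [hslice0] with t ht
      have : (fun y => ‖uncurry u (t, y)‖ₑ) =ᵐ[volume] fun _ => 0 := by
        filter_upwards [ht] with y hy
        simp [uncurry, hy]
      rw [lintegral_congr_ae this]
      simp
    rw [lintegral_congr_ae hz]
    simp
  have hae := (lintegral_eq_zero_iff' hmeasU.aemeasurable.enorm).1 hint
  filter_upwards [hae] with z hz
  simpa using hz

/-- **Backward-tight ⇒ trivial, every `ρ > 0`** (stub 2 `Backward.stub_backwardVanishing` + tightness ⇒ quiescent past).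
[folklore] -/
theorem ae_eq_zero_of_gauge_of_tight_allRho {ρ : ℝ} (hρ : 0 < ρ)
    {u : ℝ → EuclideanSpace ℝ (Fin 3) → EuclideanSpace ℝ (Fin 3)} {p : ℝ → EuclideanSpace ℝ (Fin 3) → ℝ}
    {H : ℝ → EuclideanSpace ℝ (Fin 3) → EuclideanSpace ℝ (Fin 3) →L[ℝ] EuclideanSpace ℝ (Fin 3)} {c : ℝ≥0}
    (hsw : IsSuitableWeakSolutionOn (slab (EuclideanSpace ℝ (Fin 3)) (Iio 0) isOpen_Iio) 0 0 u p)
    (hH : HasWeakSpatialGradientOn (slab (EuclideanSpace ℝ (Fin 3)) (Iio 0) isOpen_Iio) u H)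
    (hc : ∀ a : ℝ, 0 < a → ENNReal.ofReal (a ^ (2 * ρ)) * cknA a (0 : ℝ × EuclideanSpace ℝ (Fin 3)) u +
        ENNReal.ofReal (a ^ ρ) * cknE a (0 : ℝ × EuclideanSpace ℝ (Fin 3)) H +
        ENNReal.ofReal (a ^ (2 * ρ)) * cknD a (0 : ℝ × EuclideanSpace ℝ (Fin 3)) p ≤ (c : ℝ≥0∞))
    (htight : ∀ ε : ℝ, 0 < ε → ∃ R : ℝ, 0 < R ∧ ∃ N : ℝ, ∀ᵐ s ∂(volume : Measure ℝ), s < -N →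
      ∫⁻ x in (ball (0 : EuclideanSpace ℝ (Fin 3)) R)ᶜ, ‖u s x‖ₑ ^ 2 ≤ ENNReal.ofReal ε) :
    uncurry u =ᵐ[volume.restrict (Iio (0 : ℝ) ×ˢ (univ : Set (EuclideanSpace ℝ (Fin 3))))] 0 := by
  refine ae_eq_zero_of_gauge_of_energyVanishing_allRho hρ.le hsw hH hc fun ε hε N => ?_
  -- tightness at level `ε/2` beyond the ball `B(0,R)`, for a.e. `s < -N₁`
  obtain ⟨R, hR, N₁, hN₁⟩ := htight (ε / 2) (by positivity)
  -- stub 2: the proportion of times in `(−a²,0)` at which `B(0,R)` holds energy `> ε/2` tends to `0`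
  have hvb := Backward.stub_backwardVanishing ρ hρ u p H c ⟨hsw, hH, hc⟩ R (ε / 2) hR (by positivity)
  set Bad : ℝ → Set ℝ := fun a => {τ : ℝ | τ ∈ Ioo (-(a ^ 2)) 0 ∧
    ENNReal.ofReal (ε / 2) < ∫⁻ y in ball (0 : EuclideanSpace ℝ (Fin 3)) R, ‖u τ y‖ₑ ^ 2} with hBad
  set M : ℝ := max (max N N₁) 0 with hM
  have hMN : N ≤ M := (le_max_left _ _).trans (le_max_left _ _)
  have hMN₁ : N₁ ≤ M := (le_max_right _ _).trans (le_max_left _ _)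
  have hM0 : 0 ≤ M := le_max_right _ _
  have hev1 : ∀ᶠ a : ℝ in atTop, volume (Bad a) / ENNReal.ofReal (a ^ 2) < 1 / 2 :=
    (tendsto_order.1 hvb).2 _ (by norm_num)
  have hev2 : ∀ᶠ a : ℝ in atTop, 2 * M + 2 < a ^ 2 :=
    (tendsto_pow_atTop two_ne_zero).eventually_gt_atTop _
  obtain ⟨a, ha1, ha2, ha0⟩ := (hev1.and (hev2.and (eventually_gt_atTop 0))).exists
  have ha2pos : 0 < a ^ 2 := by positivity
  have hBadlt : volume (Bad a) < 1 / 2 * ENNReal.ofReal (a ^ 2) := by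
    rwa [ENNReal.div_lt_iff (Or.inl ((ENNReal.ofReal_pos.2 ha2pos).ne')) (Or.inl ENNReal.ofReal_ne_top)] at ha1
  -- the candidate set of quiescent times: early, not bad, and outside the null set where tightness fails
  set Tfail : Set ℝ := {s : ℝ | ¬ (s < -N₁ →
    ∫⁻ x in (ball (0 : EuclideanSpace ℝ (Fin 3)) R)ᶜ, ‖u s x‖ₑ ^ 2 ≤ ENNReal.ofReal (ε / 2))} with hTfail
  have hTnull : volume Tfail = 0 := ae_iff.1 hN₁
  set A : Set ℝ := (Ioo (-(a ^ 2)) (-M) \ Bad a) \ Tfail with hAdef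
  have hApos : volume A ≠ 0 := by
    intro hA0
    have h0 : volume (Ioo (-(a ^ 2)) (-M) \ Bad a) = 0 := by
      have h1 := measure_sdiff_null (s := Ioo (-(a ^ 2)) (-M) \ Bad a) hTnull
      rw [← h1]; exact hA0
    have h1 : volume (Ioo (-(a ^ 2)) (-M)) - volume (Bad a) ≤ volume (Ioo (-(a ^ 2)) (-M) \ Bad a) :=
      le_measure_sdiff
    rw [h0, nonpos_iff_eq_zero, tsub_eq_zero_iff_le, Real.volume_Ioo] at h1
    have h2 : ENNReal.ofReal (-M - -(a ^ 2)) < 1 / 2 * ENNReal.ofReal (a ^ 2) := lt_of_le_of_lt h1 hBadlt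
    rw [show (1 / 2 : ℝ≥0∞) = ENNReal.ofReal (1 / 2) by rw [ENNReal.ofReal_div_of_pos two_pos]; simp,
      ← ENNReal.ofReal_mul (by norm_num), ENNReal.ofReal_lt_ofReal_iff (by positivity)] at h2
    linarith
  -- every time in `A` is quiescent at level `ε` and earlier than `-N`
  have hAsub : A ⊆ {s : ℝ | s < -N ∧ ∫⁻ x, ‖u s x‖ₑ ^ 2 ≤ ENNReal.ofReal ε} := by
    intro s hs
    have hsI : s ∈ Ioo (-(a ^ 2)) (-M) := hs.1.1
    have hsBad : s ∉ Bad a := hs.1.2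
    have hsT : s ∉ Tfail := hs.2
    have hsN : s < -N := lt_of_lt_of_le hsI.2 (by linarith)
    have hsN₁ : s < -N₁ := lt_of_lt_of_le hsI.2 (by linarith)
    have hsneg : s < 0 := lt_of_lt_of_le hsI.2 (by linarith)
    have hin : ∫⁻ y in ball (0 : EuclideanSpace ℝ (Fin 3)) R, ‖u s y‖ₑ ^ 2 ≤ ENNReal.ofReal (ε / 2) := by
      by_contra hlt
      exact hsBad ⟨⟨hsI.1, hsneg⟩, not_le.1 hlt⟩
    have hout : ∫⁻ x in (ball (0 : EuclideanSpace ℝ (Fin 3)) R)ᶜ, ‖u s x‖ₑ ^ 2 ≤ ENNReal.ofReal (ε / 2) := by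
      have : s < -N₁ → ∫⁻ x in (ball (0 : EuclideanSpace ℝ (Fin 3)) R)ᶜ, ‖u s x‖ₑ ^ 2 ≤
          ENNReal.ofReal (ε / 2) := by
        simpa only [hTfail, mem_setOf_eq, not_not] using hsT
      exact this hsN₁
    refine ⟨hsN, ?_⟩
    calc ∫⁻ x, ‖u s x‖ₑ ^ 2
        = (∫⁻ x in ball (0 : EuclideanSpace ℝ (Fin 3)) R, ‖u s x‖ₑ ^ 2) +
            ∫⁻ x in (ball (0 : EuclideanSpace ℝ (Fin 3)) R)ᶜ, ‖u s x‖ₑ ^ 2 :=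
          (lintegral_add_compl _ measurableSet_ball).symm
      _ ≤ ENNReal.ofReal (ε / 2) + ENNReal.ofReal (ε / 2) := add_le_add hin hout
      _ = ENNReal.ofReal ε := by
          rw [← ENNReal.ofReal_add (by positivity) (by positivity)]; congr 1; ring
  exact fun h0 => hApos (measure_mono_null hAsub h0)

/-! ## The crux VERBATIM plus one hypothesis, every `ρ > 0` -/

/-- **«No Euler collapse from an energy-quiescent past», every `ρ > 0`.** [folklore] -/
theorem powerGaugeEulerLiouville_of_energyVanishing_allRho :
    ∀ ρ : ℝ, 0 < ρ → ∀ (u : ℝ → EuclideanSpace ℝ (Fin 3) → EuclideanSpace ℝ (Fin 3))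
      (p : ℝ → EuclideanSpace ℝ (Fin 3) → ℝ)
      (H : ℝ → EuclideanSpace ℝ (Fin 3) → EuclideanSpace ℝ (Fin 3) →L[ℝ] EuclideanSpace ℝ (Fin 3)) (c : ℝ≥0),
      IsSuitableWeakSolutionOn (slab (EuclideanSpace ℝ (Fin 3)) (Set.Iio 0) isOpen_Iio) 0 0 u p →
      HasWeakSpatialGradientOn (slab (EuclideanSpace ℝ (Fin 3)) (Set.Iio 0) isOpen_Iio) u H →
      (∀ a : ℝ, 0 < a → ENNReal.ofReal (a ^ (2 * ρ)) * cknA a (0 : ℝ × EuclideanSpace ℝ (Fin 3)) u +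
        ENNReal.ofReal (a ^ ρ) * cknE a (0 : ℝ × EuclideanSpace ℝ (Fin 3)) H +
        ENNReal.ofReal (a ^ (2 * ρ)) * cknD a (0 : ℝ × EuclideanSpace ℝ (Fin 3)) p ≤ (c : ℝ≥0∞)) →
      (∀ ε : ℝ, 0 < ε → ∀ N : ℝ,
        volume {s : ℝ | s < -N ∧ ∫⁻ x, ‖u s x‖ₑ ^ 2 ≤ ENNReal.ofReal ε} ≠ 0) →
      Function.uncurry u =ᵐ[volume.restrict (Set.Iio (0 : ℝ) ×ˢ (Set.univ : Set (EuclideanSpace ℝ (Fin 3))))] 0 :=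
  fun _ hρ _ _ _ _ hsw hH hc hvan => ae_eq_zero_of_gauge_of_energyVanishing_allRho hρ.le hsw hH hc hvan

/-- **«No Euler collapse from rest», every `ρ > 0`** (rest before `−T` ⇒ energy-quiescent past). [folklore] -/
theorem powerGaugeEulerLiouville_fromRest_allRho :
    ∀ ρ : ℝ, 0 < ρ → ∀ (u : ℝ → EuclideanSpace ℝ (Fin 3) → EuclideanSpace ℝ (Fin 3))
      (p : ℝ → EuclideanSpace ℝ (Fin 3) → ℝ)
      (H : ℝ → EuclideanSpace ℝ (Fin 3) → EuclideanSpace ℝ (Fin 3) →L[ℝ] EuclideanSpace ℝ (Fin 3)) (c : ℝ≥0),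
      IsSuitableWeakSolutionOn (slab (EuclideanSpace ℝ (Fin 3)) (Set.Iio 0) isOpen_Iio) 0 0 u p →
      HasWeakSpatialGradientOn (slab (EuclideanSpace ℝ (Fin 3)) (Set.Iio 0) isOpen_Iio) u H →
      (∀ a : ℝ, 0 < a → ENNReal.ofReal (a ^ (2 * ρ)) * cknA a (0 : ℝ × EuclideanSpace ℝ (Fin 3)) u +
        ENNReal.ofReal (a ^ ρ) * cknE a (0 : ℝ × EuclideanSpace ℝ (Fin 3)) H +
        ENNReal.ofReal (a ^ (2 * ρ)) * cknD a (0 : ℝ × EuclideanSpace ℝ (Fin 3)) p ≤ (c : ℝ≥0∞)) →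
      (∃ T : ℝ, ∀ t : ℝ, t < -T → ∀ x : EuclideanSpace ℝ (Fin 3), u t x = 0) →
      Function.uncurry u =ᵐ[volume.restrict (Set.Iio (0 : ℝ) ×ˢ (Set.univ : Set (EuclideanSpace ℝ (Fin 3))))] 0 := by
  intro ρ hρ u p H c hsw hH hc ⟨T, hT⟩
  refine ae_eq_zero_of_gauge_of_energyVanishing_allRho hρ.le hsw hH hc fun ε hε N => ?_
  have hsub : Set.Ioo (-(max N T) - 1) (-(max N T)) ⊆ {s : ℝ | s < -N ∧ ∫⁻ x, ‖u s x‖ₑ ^ 2 ≤ ENNReal.ofReal ε} := by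
    intro s hs
    have h1 : s < -N := lt_of_lt_of_le hs.2 (neg_le_neg (le_max_left _ _))
    have h2 : s < -T := lt_of_lt_of_le hs.2 (neg_le_neg (le_max_right _ _))
    refine ⟨h1, ?_⟩
    have : (fun x => ‖u s x‖ₑ ^ 2) = fun _ => 0 := by
      funext x; rw [hT s h2 x]; simp
    rw [this, lintegral_zero]; exact zero_le
  intro h0
  have := measure_mono_null hsub h0
  rw [Real.volume_Ioo] at this
  have h1 : (0 : ℝ≥0∞) < ENNReal.ofReal (-(max N T) - (-(max N T) - 1)) := ENNReal.ofReal_pos.2 (by linarith)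
  exact h1.ne' this

/-- **«No backward-tight nontrivial member», every `ρ > 0`:** a nontrivial member of the class, for ANY `ρ ∈ (0, 1/2]`,
sends its energy to spatial infinity backward in time. [folklore] -/
theorem powerGaugeEulerLiouville_of_tightPast_allRho :
    ∀ ρ : ℝ, 0 < ρ → ∀ (u : ℝ → EuclideanSpace ℝ (Fin 3) → EuclideanSpace ℝ (Fin 3))
      (p : ℝ → EuclideanSpace ℝ (Fin 3) → ℝ)
      (H : ℝ → EuclideanSpace ℝ (Fin 3) → EuclideanSpace ℝ (Fin 3) →L[ℝ] EuclideanSpace ℝ (Fin 3)) (c : ℝ≥0),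
      IsSuitableWeakSolutionOn (slab (EuclideanSpace ℝ (Fin 3)) (Set.Iio 0) isOpen_Iio) 0 0 u p →
      HasWeakSpatialGradientOn (slab (EuclideanSpace ℝ (Fin 3)) (Set.Iio 0) isOpen_Iio) u H →
      (∀ a : ℝ, 0 < a → ENNReal.ofReal (a ^ (2 * ρ)) * cknA a (0 : ℝ × EuclideanSpace ℝ (Fin 3)) u +
        ENNReal.ofReal (a ^ ρ) * cknE a (0 : ℝ × EuclideanSpace ℝ (Fin 3)) H +
        ENNReal.ofReal (a ^ (2 * ρ)) * cknD a (0 : ℝ × EuclideanSpace ℝ (Fin 3)) p ≤ (c : ℝ≥0∞)) →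
      (∀ ε : ℝ, 0 < ε → ∃ R : ℝ, 0 < R ∧ ∃ N : ℝ, ∀ᵐ s ∂(volume : Measure ℝ), s < -N →
        ∫⁻ x in (ball (0 : EuclideanSpace ℝ (Fin 3)) R)ᶜ, ‖u s x‖ₑ ^ 2 ≤ ENNReal.ofReal ε) →
      Function.uncurry u =ᵐ[volume.restrict (Set.Iio (0 : ℝ) ×ˢ (Set.univ : Set (EuclideanSpace ℝ (Fin 3))))] 0 :=
  fun _ hρ _ _ _ _ hsw hH hc htight => ae_eq_zero_of_gauge_of_tight_allRho hρ hsw hH hc htight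

end Summit.NavierStokesRegularity.NavierStokesRegularity.Theorems.PowerGaugeEulerLiouville

end
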